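import Mathlib
import Summits.ValiantsHypothesis.ValiantsHypothesis.Theorems.KPlusLogSqLawMonotonePencilInertia
import Summits.ValiantsHypothesis.ValiantsHypothesis.Theorems.KPlusLogSqLawWeakLiftingTowerGraftCoEulerZone

/-!
# Tower graft line — ZONE FLUX: in a Loewner-monotone zone the determinant zeros are paid by the INERTIA FLUX through the zone
# (sharp form of the steep-zone / co-Euler-zone laws: `#zeros + ν₋(exit) ≤ ν₋(entrance)`)

Structure file for LINE (B) `Cruxes/WeakLifting/Lines/tower_graft.lean` (crux `WeakLifting` = stmt-ValiantsHypothesis-19561), sequel of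
`…TowerGraftSteepZone` (interval Loewner law, `≤ card ι`) and `…TowerGraftCoEulerZone` (weight `u^{−D}`, any far letter).  Those files price a
monotone zone at `m = card ι`; the sharp price is the NEGATIVE-INERTIA FLUX through the zone, which TELESCOPES along a chain of zones:

§1 `ZoneFlux.card_add_negInertia_le` (abstract): `H : ℝ → Matrix ι ι ℝ` symmetric with positive definite increments on `[a, b]` (`a ≤ b`; NO
   positivity of `a` needed) ⇒ `#{distinct zeros of det H in (a, b]} + ν₋(H b) ≤ ν₋(H a)`, where `ν₋(A) = #{k : λ↓ₖ(A) < 0}` (sorted eigenvalues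
   `IsHermitian.eigenvalues₀`, written inline).  Mechanism: each `λ↓ₖ(H ·)` is strictly increasing on `[a, b]` (strict Weyl,
   `MonotoneInertia.eigenvalues₀_lt_of_posDef`); a zero `t` has a vanishing index `k_t` (`LoewnerInterlacing.exists_eigenvalues₀_eq_zero`), distinct
   zeros have distinct indices, every `k_t` is negative at `a` and non-negative at `b`; so `{k_t} ⊔ {k : λ↓ₖ(H b) < 0} ⊆ {k : λ↓ₖ(H a) < 0}`.
§2 `card_add_negInertia_le_of_eulerDeriv` — the same for the polynomial family `Σ_l u^{e_l}•T_l` under `θH ≻ 0` on `[a, b]` (`a > 0`).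
§3 THE DEFINITE GRAFT, FLUX FORM (`card_roots_Ioi_definiteGraft_add_le_negInertia`, `…_le_negInertia_base`, `eq_zero_of_base_posSemidef`):
   in the steep zone `[a, ∞)` of `G + X^D·P` (`P ⪰ c·1`, row margin as in `…SteepZone`) the roots beyond `a` number at most
   `ν₋(G(a) + a^D P) ≤ ν₋(G(a))` — THE NEGATIVE INERTIA OF THE BASE AT THE ZONE ENTRANCE, a class quantity at ONE point; in particular
   `G(a) ⪰ 0` ⇒ NO root beyond `a` (the letter zone of `…OperatorRoucheLetterZone` recovered and extended down to the steep-zone entrance).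
§4 THE CO-EULER ZONE, FLUX FORM (`card_roots_Ico_graft_add_negInertia_le`): where the co-Euler base `Σ_l (D − d_l)u^{d_l}S_l ≻ 0` on `[a, b]`,
   for ANY symmetric far letter `S`: `#{roots in [a, b)} + ν₋(W(1/a)) ≤ ν₋(W(1/b))` for the reversed family `W(s) = Σ_l s^{D−d_l}S_l + S`
   (`W(1/u) = u^{−D}·(G(u) + u^D S)` has the inertia of `G(u) + u^D S`): the graft's negative inertia can only GROW through such a zone, by at
   least the number of roots.
READING FOR THE LINE (honest): along any partition of `(0, ∞)` into monotone zones (of either weight) and residual zones, the monotone zones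
together cost at most the total variation of `u ↦ ν₋(G(u) + u^D S)` across them; the residual (indefinite co-Euler base, sub-steep letter) zones
are S4/S5's research content and are NOT addressed.  Zero stub credit; S4/S4b/S5, TowerB, `WeakLifting`, Conjecture B, 18050, VP ≠ VNP untouched.
Def-free; Mathlib + `…MonotonePencilInertia` (strict Weyl, vanishing index) + `…TowerGraftCoEulerZone`/`…SteepZone`.  Seat: prover val-sym-lift-p2
g23, `--supports stmt-ValiantsHypothesis-19561 --as helper`.  [folklore: Weyl monotonicity / Sylvester inertia; the packaging for the line is this work]
-/

-- `Summit.ValiantsHypothesis.ValiantsHypothesis.…` repeats a component by the D-0017 layout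
-- (single-conjunct summit), which the `dupNamespace` linter flags; the name is mandated.
set_option linter.dupNamespace false
set_option autoImplicit false

namespace Summit.ValiantsHypothesis.ValiantsHypothesis.Theorems.KPlusLogSqLaw.TowerGraft

open Matrix Finset Polynomial
open scoped BigOperators
open Summit.ValiantsHypothesis.ValiantsHypothesis.Theorems.KPlusLogSqLaw (MonotoneInertia.eigenvalues₀_lt_of_posDef
  LoewnerInterlacing.exists_eigenvalues₀_eq_zero LoewnerInterlacing.eigenvalues₀_mono)

namespace ZoneFlux

/-! ## §1 The abstract flux law -/

section Abstract

variable {ι : Type} [Fintype ι] [DecidableEq ι]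

/-- sorted eigenvalues are monotone along a family with positive definite increments on `[a, b]` (non-strict form, `s ≤ t`). [folklore] -/
theorem eigenvalues₀_le_of_increments (H : ℝ → Matrix ι ι ℝ) (hH : ∀ u, (H u).IsHermitian) {a b : ℝ}
    (hinc : ∀ s t : ℝ, a ≤ s → s < t → t ≤ b → (H t - H s).PosDef) {s t : ℝ} (hs : a ≤ s) (hst : s ≤ t) (ht : t ≤ b)
    (k : Fin (Fintype.card ι)) : (hH s).eigenvalues₀ k ≤ (hH t).eigenvalues₀ k := by
  rcases hst.eq_or_lt with rfl | hlt
  · exact le_rfl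
  · exact (MonotoneInertia.eigenvalues₀_lt_of_posDef (hH s) (hinc s t hs hlt ht) (by abel) (hH t) k).le

/-- **ZONE FLUX LAW (abstract).**  `H` real symmetric with positive definite increments on `[a, b]` (`a ≤ b`): the distinct zeros of `det H`
in `(a, b]` plus the negative inertia at the exit `b` number at most the negative inertia at the entrance `a`:
`#T + #{k : λ↓ₖ(H b) < 0} ≤ #{k : λ↓ₖ(H a) < 0}`. [folklore: strict Weyl monotonicity + a vanishing index per zero; packaging this work] -/
theorem card_add_negInertia_le (H : ℝ → Matrix ι ι ℝ) (hH : ∀ u, (H u).IsHermitian) {a b : ℝ} (hab : a ≤ b)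
    (hinc : ∀ s t : ℝ, a ≤ s → s < t → t ≤ b → (H t - H s).PosDef)
    (T : Finset ℝ) (hT : ∀ t ∈ T, a < t ∧ t ≤ b ∧ (H t).det = 0) :
    T.card + (univ.filter fun k => (hH b).eigenvalues₀ k < 0).card ≤ (univ.filter fun k => (hH a).eigenvalues₀ k < 0).card := by
  classical
  -- empty index type: no zeros at all
  by_cases hι : Fintype.card ι = 0
  · haveI : IsEmpty ι := Fintype.card_eq_zero_iff.mp hι
    have hTe : T = ∅ := Finset.eq_empty_of_forall_notMem fun t ht => by
      have h := (hT t ht).2.2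
      rw [Matrix.det_isEmpty] at h
      exact one_ne_zero h
    subst hTe
    have hNb : (univ.filter fun k => (hH b).eigenvalues₀ k < 0) = ∅ :=
      Finset.eq_empty_of_forall_notMem fun k _ => (Fin.cast hι k).elim0
    simp [hNb]
  haveI : Nonempty (Fin (Fintype.card ι)) := ⟨⟨0, Nat.pos_of_ne_zero hι⟩⟩
  -- a vanishing index for every zero
  have hidx : ∀ t ∈ T, ∃ k : Fin (Fintype.card ι), (hH t).eigenvalues₀ k = 0 := fun t ht =>
    LoewnerInterlacing.exists_eigenvalues₀_eq_zero (hH t) (hT t ht).2.2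
  choose! kf hkf using hidx
  -- the index map is injective on `T`
  have hinj : Set.InjOn kf T := by
    intro t₁ h₁ t₂ h₂ heq
    by_contra hne
    rcases lt_or_gt_of_ne hne with hlt | hlt
    · have h := MonotoneInertia.eigenvalues₀_lt_of_posDef (hH t₁) (hinc t₁ t₂ (hT t₁ h₁).1.le hlt (hT t₂ h₂).2.1) (by abel) (hH t₂) (kf t₁)
      rw [hkf t₁ h₁, heq, hkf t₂ h₂] at h
      exact lt_irrefl _ h
    · have h := MonotoneInertia.eigenvalues₀_lt_of_posDef (hH t₂) (hinc t₂ t₁ (hT t₂ h₂).1.le hlt (hT t₁ h₁).2.1) (by abel) (hH t₁) (kf t₂)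
      rw [hkf t₂ h₂, ← heq, hkf t₁ h₁] at h
      exact lt_irrefl _ h
  -- every vanishing index is negative at `a` …
  have hneg_a : ∀ t ∈ T, (hH a).eigenvalues₀ (kf t) < 0 := by
    intro t ht
    have h := MonotoneInertia.eigenvalues₀_lt_of_posDef (hH a) (hinc a t le_rfl (hT t ht).1 (hT t ht).2.1) (by abel) (hH t) (kf t)
    rwa [hkf t ht] at h
  -- … and non-negative at `b`
  have hnonneg_b : ∀ t ∈ T, 0 ≤ (hH b).eigenvalues₀ (kf t) := by
    intro t ht
    have h := eigenvalues₀_le_of_increments H hH hinc (hT t ht).1.le (hT t ht).2.1 le_rfl (kf t)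
    rwa [hkf t ht] at h
  -- the two index sets are disjoint and both inside the negative set at `a`
  set Na := univ.filter fun k => (hH a).eigenvalues₀ k < 0 with hNa
  set Nb := univ.filter fun k => (hH b).eigenvalues₀ k < 0 with hNb
  have hsubI : T.image kf ⊆ Na := by
    intro k hk
    rw [Finset.mem_image] at hk
    obtain ⟨t, ht, rfl⟩ := hk
    exact Finset.mem_filter.mpr ⟨Finset.mem_univ _, hneg_a t ht⟩
  have hsubB : Nb ⊆ Na := by
    intro k hk
    rw [hNb, Finset.mem_filter] at hk
    exact Finset.mem_filter.mpr ⟨Finset.mem_univ _,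
      (eigenvalues₀_le_of_increments H hH hinc le_rfl hab le_rfl k).trans_lt hk.2⟩
  have hdisj : Disjoint (T.image kf) Nb := by
    rw [Finset.disjoint_left]
    intro k hk hkb
    rw [Finset.mem_image] at hk
    obtain ⟨t, ht, rfl⟩ := hk
    rw [hNb, Finset.mem_filter] at hkb
    exact absurd hkb.2 (not_lt.mpr (hnonneg_b t ht))
  calc T.card + Nb.card = (T.image kf).card + Nb.card := by rw [Finset.card_image_of_injOn hinj]
    _ = (T.image kf ∪ Nb).card := (Finset.card_union_of_disjoint hdisj).symm
    _ ≤ Na.card := Finset.card_le_card (Finset.union_subset hsubI hsubB)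

/-- adding a positive semidefinite matrix does not increase the negative inertia (`λ↓ₖ` monotone). [folklore] -/
theorem negInertia_add_posSemidef_le {A P : Matrix ι ι ℝ} (hA : A.IsHermitian) (hP : P.PosSemidef) (hAP : (A + P).IsHermitian) :
    (univ.filter fun k => hAP.eigenvalues₀ k < 0).card ≤ (univ.filter fun k => hA.eigenvalues₀ k < 0).card := by
  refine Finset.card_le_card fun k hk => ?_
  rw [Finset.mem_filter] at hk ⊢
  exact ⟨hk.1, (LoewnerInterlacing.eigenvalues₀_mono hA hAP (by simpa using hP) k).trans_lt hk.2⟩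

/-- a positive semidefinite matrix has negative inertia `0`. [folklore] -/
theorem negInertia_eq_zero_of_posSemidef {A : Matrix ι ι ℝ} (hA : A.PosSemidef) :
    (univ.filter fun k => hA.1.eigenvalues₀ k < 0).card = 0 := by
  rw [Finset.card_eq_zero, Finset.filter_eq_empty_iff]
  intro k _
  have h := hA.eigenvalues_nonneg ((Fintype.equivOfCardEq (Fintype.card_fin _)) k)
  have h' : 0 ≤ hA.1.eigenvalues₀ k := by simpa [Matrix.IsHermitian.eigenvalues] using h
  exact not_lt.mpr h'

end Abstract

/-! ## §2 The polynomial family under `θH ≻ 0` -/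

section Euler

variable {ι : Type} [Fintype ι] [DecidableEq ι] {κ : Type} [Fintype κ]

/-- **flux law under the derivative criterion**: `H u = Σ_l u^{e_l}•T_l`, symmetric letters, `θH ≻ 0` on `[a, b]` (`0 < a ≤ b`) ⇒
`#{zeros of det H in (a, b]} + ν₋(H b) ≤ ν₋(H a)`. [this work] -/
theorem card_add_negInertia_le_of_eulerDeriv (e : κ → ℕ) (Tm : κ → Matrix ι ι ℝ) (hTm : ∀ l, (Tm l).IsSymm) {a b : ℝ}
    (ha : 0 < a) (hab : a ≤ b) (hθ : ∀ u, a ≤ u → u ≤ b → (∑ l, ((e l : ℝ) * u ^ e l) • Tm l).PosDef)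
    (T : Finset ℝ) (hT : ∀ t ∈ T, a < t ∧ t ≤ b ∧ (∑ l, (t ^ e l) • Tm l).det = 0) :
    T.card + (univ.filter fun k => (SteepZone.isHermitian_family (fun l => b ^ e l) Tm hTm).eigenvalues₀ k < 0).card ≤
      (univ.filter fun k => (SteepZone.isHermitian_family (fun l => a ^ e l) Tm hTm).eigenvalues₀ k < 0).card :=
  card_add_negInertia_le (fun u => ∑ l, (u ^ e l) • Tm l) (fun u => SteepZone.isHermitian_family (fun l => u ^ e l) Tm hTm) hab
    (SteepZone.posDef_increments_of_eulerDeriv e Tm hTm ha hθ) T hT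

end Euler

/-! ## §3 The definite graft: roots beyond the steep-zone entrance are paid by the base's negative inertia there -/

section Graft

variable {m K : ℕ}

/-- the graft family `Σ_l u^{d_l} S_l + u^D P` is Hermitian for symmetric letters. [folklore] -/
theorem isHermitian_graft (D : ℕ) (d : Fin K → ℕ) (S : Fin K → Matrix (Fin m) (Fin m) ℝ) (hS : ∀ l, (S l).IsSymm)
    (P : Matrix (Fin m) (Fin m) ℝ) (hPs : P.IsSymm) (u : ℝ) : ((∑ l, (u ^ d l) • S l) + (u ^ D) • P).IsHermitian := by
  have h1 : (∑ l, (u ^ d l) • S l).IsHermitian := SteepZone.isHermitian_family (fun l => u ^ d l) S hS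
  have h2 : ((u ^ D) • P).IsHermitian := by
    unfold Matrix.IsHermitian
    rw [Matrix.conjTranspose_smul, star_trivial, Matrix.conjTranspose_eq_transpose_of_trivial, hPs.eq]
  exact h1.add h2

/-- **DEFINITE GRAFT, FLUX FORM.**  `G = Σ_l X^{d_l}S_l` (symmetric `m × m` letters), `P ⪰ c·1` symmetric, `a > 0`, and the steep-zone row
margin `Σ_l d_l u^{d_l}·Σ_j|S_l i j| < D u^D·c` for every row along `[a, ∞)`: the roots of `det (G + X^D·P)` in `(a, ∞)` number at most
`ν₋(G(a) + a^D P)`, the negative inertia of the graft at the zone entrance. [this work] -/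
theorem card_roots_Ioi_definiteGraft_le_negInertia (D : ℕ) (d : Fin K → ℕ) (S : Fin K → Matrix (Fin m) (Fin m) ℝ)
    (hS : ∀ l, (S l).IsSymm) (P : Matrix (Fin m) (Fin m) ℝ) (hPs : P.IsSymm) {c a : ℝ}
    (hP : (P - c • (1 : Matrix (Fin m) (Fin m) ℝ)).PosSemidef) (ha : 0 < a)
    (hzone : ∀ u, a ≤ u → ∀ i, (∑ l, (d l : ℝ) * u ^ d l * ∑ j, |S l i j|) < (D : ℝ) * u ^ D * c) :
    ((Matrix.det ((∑ l, ((X : ℝ[X]) ^ d l) • (S l).map C) + ((X : ℝ[X]) ^ D) • P.map C)).roots.toFinset.filter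
      (fun t => a < t)).card ≤
      (univ.filter fun k => (isHermitian_graft D d S hS P hPs a).eigenvalues₀ k < 0).card := by
  classical
  set f := Matrix.det ((∑ l, ((X : ℝ[X]) ^ d l) • (S l).map C) + ((X : ℝ[X]) ^ D) • P.map C) with hf
  set T := f.roots.toFinset.filter (fun t => a < t) with hT
  -- the snoc family and its Euler derivative (as in `…SteepZone`)
  let e : Fin (K + 1) → ℕ := Fin.snoc d D
  let Tm : Fin (K + 1) → Matrix (Fin m) (Fin m) ℝ := Fin.snoc S P
  have hTm : ∀ l, (Tm l).IsSymm := by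
    intro l
    induction l using Fin.lastCases with
    | last => simpa [Tm] using hPs
    | cast l => simpa [Tm] using hS l
  have hθ : ∀ u, a ≤ u → (∑ l, ((e l : ℝ) * u ^ e l) • Tm l).PosDef := by
    intro u hu
    have hu0 : 0 < u := ha.trans_le hu
    refine SteepZone.eulerDeriv_posDef_of_rowMargin e Tm hTm (Fin.last K) (c := c) (by simpa [Tm] using hP) hu0 fun i => ?_
    have hset : (univ.erase (Fin.last K) : Finset (Fin (K + 1))) = univ.map Fin.castSuccEmb := by
      ext l
      simp only [Finset.mem_erase, Finset.mem_univ, and_true, Finset.mem_map, Fin.castSuccEmb_apply, true_and]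
      constructor
      · intro hl
        exact ⟨l.castPred hl, Fin.castSucc_castPred _ _⟩
      · rintro ⟨l', rfl⟩
        exact Fin.castSucc_ne_last l'
    rw [hset, Finset.sum_map]
    simpa [e, Tm] using hzone u hu i
  -- the family equals the graft family
  have hfam : ∀ u : ℝ, (∑ l, (u ^ e l) • Tm l) = (∑ l, (u ^ d l) • S l) + (u ^ D) • P := by
    intro u
    show (∑ l : Fin (K + 1), (u ^ (Fin.snoc d D : Fin (K + 1) → ℕ) l) • (Fin.snoc S P : Fin (K + 1) → _) l) = _
    rw [Fin.sum_univ_castSucc]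
    simp only [Fin.snoc_castSucc, Fin.snoc_last]
  -- an exit point beyond every root
  set b : ℝ := (∑ t ∈ T, |t|) + a + 1 with hb
  have hab : a ≤ b := by
    have : 0 ≤ ∑ t ∈ T, |t| := Finset.sum_nonneg fun t _ => abs_nonneg t
    linarith
  have hTb : ∀ t ∈ T, t ≤ b := by
    intro t ht
    have h1 : t ≤ |t| := le_abs_self t
    have h2 : |t| ≤ ∑ t' ∈ T, |t'| := Finset.single_le_sum (fun t' _ => abs_nonneg t') ht
    linarith
  have hmem : ∀ t ∈ T, a < t ∧ t ≤ b ∧ (∑ l, (t ^ e l) • Tm l).det = 0 := by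
    intro t ht
    refine ⟨(Finset.mem_filter.mp ht).2, hTb t ht, ?_⟩
    have hr := (Polynomial.mem_roots'.mp (Multiset.mem_toFinset.mp (Finset.mem_filter.mp ht).1)).2
    rw [Polynomial.IsRoot.def, hf, SteepZone.eval_det_graft] at hr
    exact hr
  have hflux := card_add_negInertia_le_of_eulerDeriv e Tm hTm ha hab (fun u hu _ => hθ u hu) T hmem
  -- the inertia at `a` of the family is the inertia of the graft at `a` (same matrix)
  have hcongr : (univ.filter fun k => (SteepZone.isHermitian_family (fun l => a ^ e l) Tm hTm).eigenvalues₀ k < 0).card =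
      (univ.filter fun k => (isHermitian_graft D d S hS P hPs a).eigenvalues₀ k < 0).card := by
    have key : ∀ (A B : Matrix (Fin m) (Fin m) ℝ) (hA : A.IsHermitian) (hB : B.IsHermitian), A = B →
        (univ.filter fun k => hA.eigenvalues₀ k < 0).card = (univ.filter fun k => hB.eigenvalues₀ k < 0).card := by
      intro A B hA hB hAB
      subst hAB
      rfl
    exact key _ _ _ _ (hfam a)
  rw [← hcongr]
  exact le_trans (Nat.le_add_right _ _) hflux

/-- … and hence at most `ν₋(G(a))`, the NEGATIVE INERTIA OF THE BASE at the zone entrance (`a^D P ⪰ 0` cannot raise it). [this work] -/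
theorem card_roots_Ioi_definiteGraft_le_negInertia_base (D : ℕ) (d : Fin K → ℕ) (S : Fin K → Matrix (Fin m) (Fin m) ℝ)
    (hS : ∀ l, (S l).IsSymm) (P : Matrix (Fin m) (Fin m) ℝ) (hPs : P.IsSymm) {c a : ℝ} (hc : 0 < c)
    (hP : (P - c • (1 : Matrix (Fin m) (Fin m) ℝ)).PosSemidef) (ha : 0 < a)
    (hzone : ∀ u, a ≤ u → ∀ i, (∑ l, (d l : ℝ) * u ^ d l * ∑ j, |S l i j|) < (D : ℝ) * u ^ D * c) :
    ((Matrix.det ((∑ l, ((X : ℝ[X]) ^ d l) • (S l).map C) + ((X : ℝ[X]) ^ D) • P.map C)).roots.toFinset.filter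
      (fun t => a < t)).card ≤
      (univ.filter fun k => (SteepZone.isHermitian_family (fun l => a ^ d l) S hS).eigenvalues₀ k < 0).card := by
  classical
  refine (card_roots_Ioi_definiteGraft_le_negInertia D d S hS P hPs hP ha hzone).trans ?_
  -- `P ⪰ 0`, so `a^D • P ⪰ 0`
  have hP0 : P.PosSemidef := by
    have h1 : (c • (1 : Matrix (Fin m) (Fin m) ℝ)).PosSemidef := Matrix.PosSemidef.one.smul hc.le
    simpa using hP.add h1
  exact negInertia_add_posSemidef_le _ (hP0.smul (pow_nonneg ha.le D)) _

/-- **no root beyond a steep-zone entrance at which the base is positive semidefinite.** [this work] -/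
theorem card_roots_Ioi_definiteGraft_eq_zero_of_base_posSemidef (D : ℕ) (d : Fin K → ℕ) (S : Fin K → Matrix (Fin m) (Fin m) ℝ)
    (hS : ∀ l, (S l).IsSymm) (P : Matrix (Fin m) (Fin m) ℝ) (hPs : P.IsSymm) {c a : ℝ} (hc : 0 < c)
    (hP : (P - c • (1 : Matrix (Fin m) (Fin m) ℝ)).PosSemidef) (ha : 0 < a)
    (hzone : ∀ u, a ≤ u → ∀ i, (∑ l, (d l : ℝ) * u ^ d l * ∑ j, |S l i j|) < (D : ℝ) * u ^ D * c)
    (hGa : (∑ l, (a ^ d l) • S l).PosSemidef) :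
    ((Matrix.det ((∑ l, ((X : ℝ[X]) ^ d l) • (S l).map C) + ((X : ℝ[X]) ^ D) • P.map C)).roots.toFinset.filter
      (fun t => a < t)).card = 0 := by
  have h := card_roots_Ioi_definiteGraft_le_negInertia_base D d S hS P hPs hc hP ha hzone
  have h0 := negInertia_eq_zero_of_posSemidef hGa
  have hcongr : (univ.filter fun k => (SteepZone.isHermitian_family (fun l => a ^ d l) S hS).eigenvalues₀ k < 0).card =
      (univ.filter fun k => hGa.1.eigenvalues₀ k < 0).card := rfl
  omega

end Graft

/-! ## §4 The co-Euler zone, flux form (any far letter) -/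

section CoEuler

variable {m K : ℕ}

/-- **CO-EULER ZONE, FLUX FORM.**  `d_l ≤ D`, symmetric letters, ANY symmetric far letter `S`, `0 < a ≤ b`, co-Euler base
`Σ_l (D − d_l)u^{d_l}S_l ≻ 0` on `[a, b]`.  With the reversed family `W(s) = Σ_l s^{D−d_l}S_l + S` (so that `W(1/u) = u^{−D}(G(u) + u^D S)`
has the inertia of the graft at `u`): `#{roots of det (G + X^D·S) in [a, b)} + ν₋(W(1/a)) ≤ ν₋(W(1/b))` — through such a zone the graft's
negative inertia grows by at least the number of roots. [this work] -/
theorem card_roots_Ico_graft_add_negInertia_le (D : ℕ) (d : Fin K → ℕ) (hdD : ∀ l, d l ≤ D) (S : Fin K → Matrix (Fin m) (Fin m) ℝ)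
    (hS : ∀ l, (S l).IsSymm) (Sfar : Matrix (Fin m) (Fin m) ℝ) (hSfar : Sfar.IsSymm) {a b : ℝ} (ha : 0 < a) (hab : a ≤ b)
    (hdef : ∀ u, a ≤ u → u ≤ b → (∑ l, (((D - d l : ℕ) : ℝ) * u ^ d l) • S l).PosDef)
    (hW : ∀ s, ((∑ l, (s ^ (D - d l)) • S l) + Sfar).IsHermitian) :
    ((Matrix.det ((∑ l, ((X : ℝ[X]) ^ d l) • (S l).map C) + ((X : ℝ[X]) ^ D) • Sfar.map C)).roots.toFinset.filter
      (fun t => a ≤ t ∧ t < b)).card + (univ.filter fun k => (hW a⁻¹).eigenvalues₀ k < 0).card ≤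
      (univ.filter fun k => (hW b⁻¹).eigenvalues₀ k < 0).card := by
  classical
  set f := Matrix.det ((∑ l, ((X : ℝ[X]) ^ d l) • (S l).map C) + ((X : ℝ[X]) ^ D) • Sfar.map C) with hf
  set T := f.roots.toFinset.filter (fun t => a ≤ t ∧ t < b) with hT
  have hb : 0 < b := ha.trans_le hab
  let e : Fin (K + 1) → ℕ := Fin.snoc (fun l => D - d l) 0
  let Tm : Fin (K + 1) → Matrix (Fin m) (Fin m) ℝ := Fin.snoc S Sfar
  have hTm : ∀ l, (Tm l).IsSymm := by
    intro l
    induction l using Fin.lastCases with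
    | last => simpa [Tm] using hSfar
    | cast l => simpa [Tm] using hS l
  -- Euler derivative of the reversed family is positive definite on `[1/b, 1/a]` (as in `…CoEulerZone`)
  have hθ : ∀ s, b⁻¹ ≤ s → s ≤ a⁻¹ → (∑ l, ((e l : ℝ) * s ^ e l) • Tm l).PosDef := by
    intro s hs1 hs2
    have hs0 : 0 < s := (inv_pos.mpr hb).trans_le hs1
    have hu0 : s⁻¹ ≠ 0 := inv_ne_zero hs0.ne'
    have hu1 : a ≤ s⁻¹ := by rw [le_inv_comm₀ ha hs0]; exact hs2
    have hu2 : s⁻¹ ≤ b := by rw [inv_le_comm₀ hs0 hb]; exact hs1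
    have key := CoEulerZone.eulerDeriv_reversed_eq D d hdD S Sfar hu0
    rw [inv_inv] at key
    show (∑ l : Fin (K + 1), ((e l : ℝ) * s ^ e l) • Tm l).PosDef
    rw [key]
    have hP := hdef s⁻¹ hu1 hu2
    have hH : ((s ^ D) • ∑ l, (((D - d l : ℕ) : ℝ) * s⁻¹ ^ d l) • S l).IsHermitian := by
      unfold Matrix.IsHermitian
      rw [Matrix.conjTranspose_smul, star_trivial, hP.isHermitian.eq]
    refine Matrix.PosDef.of_dotProduct_mulVec_pos hH fun x hx => ?_
    rw [star_trivial, Matrix.smul_mulVec, dotProduct_smul, smul_eq_mul]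
    have h1 := hP.dotProduct_mulVec_pos hx
    rw [star_trivial] at h1
    exact mul_pos (pow_pos hs0 _) h1
  -- reversed root set
  set T' : Finset ℝ := T.image fun t => t⁻¹ with hT'
  have hcard : T'.card = T.card := Finset.card_image_of_injective _ inv_injective
  have hmem : ∀ t ∈ T, a ≤ t ∧ t < b ∧ f.eval t = 0 := by
    intro t ht
    rw [hT, Finset.mem_filter, Multiset.mem_toFinset] at ht
    exact ⟨ht.2.1, ht.2.2, (Polynomial.mem_roots'.mp ht.1).2⟩
  have hflux := card_add_negInertia_le_of_eulerDeriv e Tm hTm (inv_pos.mpr hb) ((inv_le_inv₀ hb ha).mpr hab) hθ T'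
    fun s hs => by
      rw [hT', Finset.mem_image] at hs
      obtain ⟨t, ht, rfl⟩ := hs
      obtain ⟨hat, htb, hft⟩ := hmem t ht
      have ht0 : 0 < t := ha.trans_le hat
      refine ⟨(inv_lt_inv₀ hb ht0).mpr htb, (inv_le_inv₀ ht0 ha).mpr hat, ?_⟩
      rw [← CoEulerZone.reversed_eq_family]
      exact (CoEulerZone.eval_det_graft_eq_zero_iff D d hdD S Sfar ht0.ne').mp hft
  -- identify the inertias of the family at `1/b`, `1/a` with those of `W`
  have key : ∀ (A B : Matrix (Fin m) (Fin m) ℝ) (hA : A.IsHermitian) (hB : B.IsHermitian), A = B →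
      (univ.filter fun k => hA.eigenvalues₀ k < 0).card = (univ.filter fun k => hB.eigenvalues₀ k < 0).card := by
    intro A B hA hB hAB
    subst hAB
    rfl
  have hfam : ∀ s, (∑ l, (s ^ e l) • Tm l) = (∑ l, (s ^ (D - d l)) • S l) + Sfar := fun s =>
    (CoEulerZone.reversed_eq_family D d S Sfar s).symm
  rw [← hcard, key _ _ (hW a⁻¹) (SteepZone.isHermitian_family (fun l => a⁻¹ ^ e l) Tm hTm) (hfam a⁻¹).symm,
    key _ _ (hW b⁻¹) (SteepZone.isHermitian_family (fun l => b⁻¹ ^ e l) Tm hTm) (hfam b⁻¹).symm]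
  exact hflux

end CoEuler

end ZoneFlux

end Summit.ValiantsHypothesis.ValiantsHypothesis.Theorems.KPlusLogSqLaw.TowerGraft
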